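import Literature.Analysis.FunctionSpaces.ItoFormulaProofs
import Literature.Analysis.FunctionSpaces.ItoProcessesProofs
import Literature.Probability.Process.ProgressiveDensity
import HarnessLib

/-!
# Martingales from Itô's formula: `f(V_t) - ∫₀ᵗ (b f'(V) + ½ σ² f''(V)) ds` is a martingale

Topic `Analysis/FunctionSpaces`; theorems only. The standard corollary of Itô's formula for Itô
processes (`Literature.Analysis.FunctionSpaces.ito_formula_itoProcess_ae`, proved in
`ItoFormulaProofs`) used in every "Itô's formula shows that `M_t := φ₀(X_{t∧σ})` is a bounded
martingale" step of Lawler (2005) (proof of Prop. 1.21; Prop. 6.8; Prop. 6.33): if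
`V = V₀ + ∫ b ds + ∫ σ dB` is an Itô process driven by the canonical Brownian motion, strongly
adapted to the raw Brownian filtration, with continuous paths, deterministic initial value,
values in a compact interval `[lo, hi]` and bounded progressive diffusion coefficient `σ`
(and progressive drift `b`), and `f ∈ C²(ℝ)`, then

  `M_t = f(V_t) - ∫₀ᵗ (b_s f'(V_s) + ½ σ_s² f''(V_s)) ds`

is a martingale (`Literature.Analysis.FunctionSpaces.martingale_apply_sub_timeIntegral`): by Itô's
formula `M_t = f(V₀) + K_t` almost surely for all `t`, where `K = ∫ σ f'(V) dB` is the
square-integrable Itô integral of the bounded progressive integrand `σ f'(V)`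
(`Literature.Probability.Process.exists_isItoIntegral_of_sq_integrable`), a martingale of the raw
filtration; `M` is strongly adapted (the time integral of a progressive process is adapted,
`adapted_timeIntegral`), hence a martingale as a modification of `f(V₀) + K`
(`MeasureTheory.Martingale.congr`). When the drift term vanishes identically, `f(V)` itself is a
martingale (`martingale_apply_of_itoDrift_eq_zero`).

## References

* D. Revuz, M. Yor, *Continuous Martingales and Brownian Motion* (3rd ed., 1999), Ch. IV,
  Thm (3.3) (Itô's formula) and Cor. (1.25) / Prop. (1.23) (`L²`-bounded stochastic integrals are
  martingales).
* G. F. Lawler, *Conformally Invariant Processes in the Plane* (2005), §1.10, proof of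
  Prop. 1.21 ("Itô's formula shows that `M_t := φ₀(X_{t∧σ})` is a bounded martingale").
-/

noncomputable section

open MeasureTheory Filter Topology Set
open scoped NNReal ENNReal

namespace Literature.Analysis.FunctionSpaces

open Literature.Probability.Process Literature.Probability.RandomPlanarGeometry

variable {V b σ : ℝ≥0 → (ℝ≥0 → ℝ) → ℝ} {f : ℝ → ℝ} {c lo hi Cσ : ℝ}

/-- **`f(V_t) - ∫₀ᵗ (b f'(V) + ½σ² f''(V)) ds` is a martingale** for an Itô process
`V = V₀ + ∫ b ds + ∫ σ dB` (canonical Brownian motion, raw filtration) which is strongly adapted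
with continuous paths, starts at the constant `c`, takes values in `[lo, hi]`, has progressive
drift `b` and progressive diffusion coefficient `σ` bounded by `Cσ`, and `f ∈ C²(ℝ)`. Itô's
formula (`ito_formula_itoProcess_ae_holds`) gives `f(V_t) = f(c) + ∫₀ᵗ(…) ds + K_t` a.s. with
`K = ∫ σ f'(V) dB` the square-integrable (martingale) Itô integral of the bounded progressive
integrand `σ f'(V)`.
Revuz–Yor (1999), Ch. IV, Thm (3.3); Lawler (2005), proof of Prop. 1.21.
[cite: RevuzYor1999, Ch. IV Thm (3.3) and Remark 1] -/
theorem martingale_apply_sub_timeIntegral (hf : ContDiff ℝ 2 f)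
    (hVa : StronglyAdapted brownianFiltration V) (hVc : ∀ ω, Continuous (V · ω))
    (hb : IsStronglyProgressive brownianFiltration b)
    (hσ : IsStronglyProgressive brownianFiltration σ)
    (hV : IsItoProcess V b σ brownian brownianFiltration preWienerMeasure)
    (hV0 : ∀ ω, V 0 ω = c) (hVmem : ∀ t ω, V t ω ∈ Icc lo hi) (hσbd : ∀ t ω, |σ t ω| ≤ Cσ) :
    Martingale (fun t ω ↦ f (V t ω) - timeIntegral (fun s ω ↦ b s ω * deriv f (V s ω) +
        2⁻¹ * σ s ω ^ 2 * iteratedDeriv 2 f (V s ω)) t ω) brownianFiltration preWienerMeasure := by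
  haveI := isProbabilityMeasure_preWienerMeasure'
  set D : ℝ≥0 → (ℝ≥0 → ℝ) → ℝ := fun s ω ↦ b s ω * deriv f (V s ω) +
    2⁻¹ * σ s ω ^ 2 * iteratedDeriv 2 f (V s ω) with hDdef
  have hf1 : Continuous (deriv f) := hf.continuous_deriv (by norm_num)
  have hf2 : Continuous (iteratedDeriv 2 f) := hf.continuous_iteratedDeriv 2 le_rfl
  have hVprog : IsStronglyProgressive brownianFiltration V :=
    hVa.isStronglyProgressive_of_continuous hVc
  -- the integrand `σ f'(V)` is progressive and bounded
  have hg : IsStronglyProgressive brownianFiltration (fun t ω ↦ σ t ω * deriv f (V t ω)) :=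
    hσ.mul (IsStronglyProgressive.continuous_comp hVprog hf1)
  obtain ⟨C1, hC1⟩ : ∃ C, ∀ v ∈ Icc lo hi, ‖deriv f v‖ ≤ C :=
    isCompact_Icc.exists_bound_of_continuousOn hf1.continuousOn
  have hCσ : 0 ≤ Cσ := (abs_nonneg _).trans (hσbd 0 (fun _ ↦ 0))
  have hgbd : ∀ t ω, |σ t ω * deriv f (V t ω)| ≤ Cσ * C1 := by
    intro t ω
    rw [abs_mul]
    have h1 := hC1 _ (hVmem t ω)
    rw [Real.norm_eq_abs] at h1
    exact mul_le_mul (hσbd t ω) h1 (abs_nonneg _) hCσ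
  have hfin : ∀ t : ℝ≥0, ∫⁻ ω, (∫⁻ s in Set.Icc (0 : ℝ) t, ENNReal.ofReal
      ((σ s.toNNReal ω * deriv f (V s.toNNReal ω)) ^ 2)) ∂preWienerMeasure ≠ ∞ := by
    intro t
    have hle : ∀ ω : ℝ≥0 → ℝ, (∫⁻ s in Set.Icc (0 : ℝ) t, ENNReal.ofReal
        ((σ s.toNNReal ω * deriv f (V s.toNNReal ω)) ^ 2)) ≤
        ENNReal.ofReal ((Cσ * C1) ^ 2) * volume (Set.Icc (0 : ℝ) t) := by
      intro ω
      rw [← setLIntegral_const]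
      refine lintegral_mono fun s ↦ ENNReal.ofReal_le_ofReal ?_
      have h := hgbd s.toNNReal ω
      rw [← sq_abs]
      exact pow_le_pow_left₀ (abs_nonneg _) h 2
    refine ne_top_of_le_ne_top ?_ (lintegral_mono hle)
    rw [lintegral_const, measure_univ, mul_one, Real.volume_Icc, sub_zero]
    exact ENNReal.mul_ne_top ENNReal.ofReal_ne_top ENNReal.ofReal_ne_top
  obtain ⟨K, hK, hKM, -⟩ := exists_isItoIntegral_of_sq_integrable hg hfin
  -- Itô's formula for the time-independent `f`
  have hf' : ContDiff ℝ 2 (Function.uncurry fun (_ : ℝ) (v : ℝ) ↦ f v) :=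
    hf.comp contDiff_snd
  have hito := ito_formula_itoProcess_ae_holds (fun (_ : ℝ) (v : ℝ) ↦ f v) hf'
    (fun t ↦ (hVa t).measurable) hσ hV hK
  -- the process `M` is strongly adapted
  have hDprog : IsStronglyProgressive brownianFiltration D := by
    have hσ2 : IsStronglyProgressive brownianFiltration fun s ω ↦ σ s ω ^ 2 := fun i ↦
      ((hσ i).measurable.pow_const 2).stronglyMeasurable
    exact (hb.mul (IsStronglyProgressive.continuous_comp hVprog hf1)).add
      (((isStronglyProgressive_const _ (2⁻¹ : ℝ)).mul hσ2).mul (IsStronglyProgressive.continuous_comp hVprog hf2))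
  have hMadapt : StronglyAdapted brownianFiltration
      (fun t ω ↦ f (V t ω) - timeIntegral D t ω) := fun t ↦
    (hf.continuous.comp_stronglyMeasurable (hVa t)).sub
      (adapted_timeIntegral hDprog t).stronglyMeasurable
  -- `M = f(c) + K` almost surely, for all times
  have hae : ∀ᵐ ω ∂preWienerMeasure, ∀ t,
      f (V t ω) - timeIntegral D t ω = f c + K t ω := by
    filter_upwards [hito] with ω hω t
    have h := hω t
    simp only [deriv_const, zero_add, hV0 ω] at h
    have hD : timeIntegral D t ω = ∫ s in (0 : ℝ)..t,
        (b s.toNNReal ω * deriv (fun v ↦ f v) (V s.toNNReal ω) +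
          2⁻¹ * σ s.toNNReal ω ^ 2 * iteratedDeriv 2 (fun v ↦ f v) (V s.toNNReal ω)) := rfl
    rw [hD, h]
    ring
  have hmart : Martingale (fun t ω ↦ f c + K t ω) brownianFiltration preWienerMeasure :=
    (martingale_const brownianFiltration preWienerMeasure (f c)).add hKM
  refine hmart.congr hMadapt fun t ↦ ?_
  filter_upwards [hae] with ω hω
  exact (hω t).symm

/-- **`f(V)` is a martingale when the Itô drift `b f'(V) + ½σ² f''(V)` vanishes identically**
(hypotheses as in `martingale_apply_sub_timeIntegral`). This is literally Lawler's "Itô's formula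
shows that `M_t := φ₀(X_{t∧σ})` is a bounded martingale" (proof of Prop. 1.21), for `φ₀` with
`½φ₀'' + (a/x)φ₀' = 0` along the stopped Bessel flow.
[cite: Lawler2005, Prop. 1.21] -/
theorem martingale_apply_of_itoDrift_eq_zero (hf : ContDiff ℝ 2 f)
    (hVa : StronglyAdapted brownianFiltration V) (hVc : ∀ ω, Continuous (V · ω))
    (hb : IsStronglyProgressive brownianFiltration b)
    (hσ : IsStronglyProgressive brownianFiltration σ)
    (hV : IsItoProcess V b σ brownian brownianFiltration preWienerMeasure)
    (hV0 : ∀ ω, V 0 ω = c) (hVmem : ∀ t ω, V t ω ∈ Icc lo hi) (hσbd : ∀ t ω, |σ t ω| ≤ Cσ)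
    (hdrift : ∀ s ω, b s ω * deriv f (V s ω) + 2⁻¹ * σ s ω ^ 2 * iteratedDeriv 2 f (V s ω) = 0) :
    Martingale (fun t ω ↦ f (V t ω)) brownianFiltration preWienerMeasure := by
  have h := martingale_apply_sub_timeIntegral hf hVa hVc hb hσ hV hV0 hVmem hσbd
  have hzero : ∀ t ω, timeIntegral (fun s ω ↦ b s ω * deriv f (V s ω) +
      2⁻¹ * σ s ω ^ 2 * iteratedDeriv 2 f (V s ω)) t ω = 0 := by
    intro t ω
    simp only [timeIntegral, hdrift, intervalIntegral.integral_zero]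
  simpa only [hzero, sub_zero] using h

end Literature.Analysis.FunctionSpaces
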